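import Mathlib
import Summits.AtomisticToContinuum.HydrodynamicLimit.Theorems.ImplosionDichotomyDenseExcursionProjectiveCovariance
import Summits.AtomisticToContinuum.HydrodynamicLimit.Theorems.ImplosionDichotomyDenseExcursionR2SelfSimilar

/-!
# Self-similar covariance of the hard-sphere Euler system — stub `stub_selfSimilarCovariance` (W1)

Crux `Summit.AtomisticToContinuum.HydrodynamicLimit.Theses.ImplosionDichotomy.DenseExcursion`
(stmt-AtomisticToContinuum-12586), line `r2-one-mode-two-conditions`, registered stub
`stub_selfSimilarCovariance : SelfSimilarCovariance`.

**Mathematics.** Write `s = T e^{-rτ}` (time to collapse), `(t, x) = ssMap T r x₀ (τ, ζ) =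
(T - s, x₀ + s^{1/r} ζ)`, so that `∂t/∂τ = r s`, `∂x/∂τ = -s^{1/r} ζ`, `∂x/∂ζ = s^{1/r}·Id`. For the
self-similar fields `𝒫 = s^{3-3/r} ρ∘ssMap`, `𝒱 = r s^{1-1/r} u∘ssMap`, `Θ̂ = r² s^{2-2/r} θ∘ssMap` the chain and
product rules give at a point `z = (τ, ζ)`: self-similar mass residual `= r s^{4-3/r} ·` physical one
(`ss_mass`); self-similar momentum residual `= r² s^{5-4/r} ·` physical one (`ss_momentum`; the packing
`𝒫 D(τ)³ = ρ σ³` is invariant for the growing diameter `D(τ) = σ s^{1/r-1}`, so the pressure `ρ θ Z(ρ d³)` is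
covariant); self-similar temperature residual `= r³ s^{3-2/r} ·` physical one once the typed heating
`H(τ) Θ̂ (Z - 1)`, `H = r s h(t)`, is subtracted (`ss_temperature`). Whence the three equivalences, all factors
being products of `r`, `T`, real powers of `T > 0` and exponentials, hence nonzero. Every power `s^a` is written
`T^a e^{-raτ}`; in the final algebra the composite powers are expressed through the atoms `T`, `T^{1/r}`,
`e^{-τ}`, `e^{-rτ}` and the identities close by `field_simp; ring`. Every lemma below is folklore calculus
(template: `Theorems.KidderKnobMelnikov.dual_mass / dual_momentum / dual_temperature`).
-/

noncomputable section

open Filter Set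
open scoped Topology ContDiff

namespace Summit.AtomisticToContinuum.HydrodynamicLimit.Theorems.R2OneModeTwoConditions

open Literature.MathematicalPhysics.KineticTheory (V3)

open Summit.AtomisticToContinuum.HydrodynamicLimit.Theorems.KidderKnobMelnikov (dT dX EulerZAt)

open Summit.AtomisticToContinuum.HydrodynamicLimit.Theorems.KidderKnobMelnikov

/-! ## Calculus of the self-similar map -/

section SsCalculus

variable {G : Type*} [NormedAddCommGroup G] [NormedSpace ℝ G] {T r : ℝ} {x₀ : V3} {z : ℝ × V3}

/-- `∂_τ (K e^{-cτ}) = -c K e^{-cτ}` on `ℝ × ℝ³` (the scalar prefactors of the self-similar fields). [folklore] -/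
theorem ssCov_hasFDerivAt_const_mul_exp (K c : ℝ) (z : ℝ × V3) :
    HasFDerivAt (fun w : ℝ × V3 => K * Real.exp (-(c * w.1)))
      ((-(c * (K * Real.exp (-(c * z.1))))) • ContinuousLinearMap.fst ℝ ℝ V3) z := by
  have h : HasDerivAt (fun x : ℝ => K * Real.exp (-(c * x))) (-(c * (K * Real.exp (-(c * z.1))))) z.1 := by
    refine ((((hasDerivAt_id' z.1).const_mul c).fun_neg.exp).const_mul K).congr_deriv ?_
    ring
  exact h.comp_hasFDerivAt z hasFDerivAt_fst

/-- `∂_τ (K e^{-τ}) = -K e^{-τ}` on `ℝ × ℝ³` (the space scale `T^{1/r} e^{-τ}`). [folklore] -/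
theorem ssCov_hasFDerivAt_const_mul_exp_neg (K : ℝ) (z : ℝ × V3) :
    HasFDerivAt (fun w : ℝ × V3 => K * Real.exp (-w.1))
      ((-(K * Real.exp (-z.1))) • ContinuousLinearMap.fst ℝ ℝ V3) z := by
  have h : HasDerivAt (fun x : ℝ => K * Real.exp (-x)) (-(K * Real.exp (-z.1))) z.1 := by
    refine (((hasDerivAt_id' z.1).fun_neg.exp).const_mul K).congr_deriv ?_
    ring
  exact h.comp_hasFDerivAt z hasFDerivAt_fst

/-- `∂_τ (T - T e^{-rτ}) = r T e^{-rτ}` (the physical time runs at rate `r s`). [folklore] -/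
theorem hasFDerivAt_ssTime (T r : ℝ) (z : ℝ × V3) :
    HasFDerivAt (fun w : ℝ × V3 => T - T * Real.exp (-(r * w.1)))
      ((r * (T * Real.exp (-(r * z.1)))) • ContinuousLinearMap.fst ℝ ℝ V3) z := by
  have h : HasDerivAt (fun x : ℝ => T - T * Real.exp (-(r * x))) (r * (T * Real.exp (-(r * z.1)))) z.1 := by
    refine ((((hasDerivAt_id' z.1).const_mul r).fun_neg.exp.const_mul T).const_sub T).congr_deriv ?_
    ring
  exact h.comp_hasFDerivAt z hasFDerivAt_fst

/-- The Fréchet derivative of the self-similar map: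
`D(ssMap)(τ,ζ)(τ', η) = (r s τ', s^{1/r} η - s^{1/r} τ' ζ)`. [folklore] -/
theorem hasFDerivAt_ssMap (T r : ℝ) (x₀ : V3) (z : ℝ × V3) :
    HasFDerivAt (ssMap T r x₀)
      (((r * (T * Real.exp (-(r * z.1)))) • ContinuousLinearMap.fst ℝ ℝ V3).prod
        ((T ^ (1 / r) * Real.exp (-z.1)) • ContinuousLinearMap.snd ℝ ℝ V3 +
          ((-(T ^ (1 / r) * Real.exp (-z.1))) • ContinuousLinearMap.fst ℝ ℝ V3).smulRight z.2)) z :=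
  (hasFDerivAt_ssTime T r z).prodMk
    (((ssCov_hasFDerivAt_const_mul_exp_neg (T ^ (1 / r)) z).fun_smul hasFDerivAt_snd).const_add x₀)

/-- Chain rule through the self-similar map. [folklore] -/
theorem hasFDerivAt_comp_ssMap {F : ℝ × V3 → G} (hF : DifferentiableAt ℝ F (ssMap T r x₀ z)) :
    HasFDerivAt (fun w => F (ssMap T r x₀ w))
      ((fderiv ℝ F (ssMap T r x₀ z)).comp
        (((r * (T * Real.exp (-(r * z.1)))) • ContinuousLinearMap.fst ℝ ℝ V3).prod
          ((T ^ (1 / r) * Real.exp (-z.1)) • ContinuousLinearMap.snd ℝ ℝ V3 +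
            ((-(T ^ (1 / r) * Real.exp (-z.1))) • ContinuousLinearMap.fst ℝ ℝ V3).smulRight z.2))) z :=
  hF.hasFDerivAt.comp z (hasFDerivAt_ssMap T r x₀ z)

/-- Time derivative of a composite with the self-similar map:
`∂_τ (F ∘ ssMap)(τ,ζ) = r s ∂ₜF - s^{1/r} ∑ᵢ ζᵢ ∂ᵢF` at `ssMap (τ,ζ)`. [folklore] -/
theorem fderiv_comp_ssMap_time {F : ℝ × V3 → G} (hF : DifferentiableAt ℝ F (ssMap T r x₀ z)) :
    fderiv ℝ (fun w => F (ssMap T r x₀ w)) z (1, 0) =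
      (r * (T * Real.exp (-(r * z.1)))) • fderiv ℝ F (ssMap T r x₀ z) (1, 0) +
        (-(T ^ (1 / r) * Real.exp (-z.1))) • ∑ i, z.2 i • fderiv ℝ F (ssMap T r x₀ z)
          (0, EuclideanSpace.single i 1) := by
  rw [(hasFDerivAt_comp_ssMap hF).fderiv]
  simp only [ContinuousLinearMap.coe_comp, Function.comp_apply, ContinuousLinearMap.prod_apply,
    smul_apply, ContinuousLinearMap.coe_fst', ContinuousLinearMap.coe_snd',
    add_apply, ContinuousLinearMap.smulRight_apply, smul_zero, zero_add, smul_eq_mul,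
    mul_one]
  rw [clm_apply_mk_smul]

/-- Space derivatives of a composite with the self-similar map:
`∂ᵢ (F ∘ ssMap)(τ,ζ) = s^{1/r} ∂ᵢF` at `ssMap (τ,ζ)`. [folklore] -/
theorem fderiv_comp_ssMap_space {F : ℝ × V3 → G} (hF : DifferentiableAt ℝ F (ssMap T r x₀ z)) (i : Fin 3) :
    fderiv ℝ (fun w => F (ssMap T r x₀ w)) z (0, EuclideanSpace.single i 1) =
      (T ^ (1 / r) * Real.exp (-z.1)) • fderiv ℝ F (ssMap T r x₀ z) (0, EuclideanSpace.single i 1) := by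
  rw [(hasFDerivAt_comp_ssMap hF).fderiv]
  simp only [ContinuousLinearMap.coe_comp, Function.comp_apply, ContinuousLinearMap.prod_apply,
    smul_apply, ContinuousLinearMap.coe_fst', ContinuousLinearMap.coe_snd',
    add_apply, ContinuousLinearMap.smulRight_apply, add_zero, smul_eq_mul, mul_zero,
    zero_smul]
  rw [clm_apply_zero_smul]

/-- The self-similar velocity, componentwise. [folklore] -/
theorem ssVelocity_apply (T r : ℝ) (x₀ : V3) (U : ℝ × V3 → V3) (w : ℝ × V3) (j : Fin 3) :
    ssVelocity T r x₀ U w j = r * (T ^ (1 - 1 / r) * Real.exp (-((r - 1) * w.1))) * U (ssMap T r x₀ w) j := by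
  simp only [ssVelocity, PiLp.smul_apply, smul_eq_mul]

/-- Derivative of a component of the self-similar velocity (a `C¹`-at-the-point composite). [folklore] -/
theorem hasFDerivAt_ssVelocity_apply {U : ℝ × V3 → V3} (hU : DifferentiableAt ℝ U (ssMap T r x₀ z)) (j : Fin 3) :
    HasFDerivAt (fun w => ssVelocity T r x₀ U w j)
      ((r * (T ^ (1 - 1 / r) * Real.exp (-((r - 1) * z.1)))) • fderiv ℝ (fun w => U (ssMap T r x₀ w) j) z +
        U (ssMap T r x₀ z) j •
          (r • ((-((r - 1) * (T ^ (1 - 1 / r) * Real.exp (-((r - 1) * z.1))))) •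
            ContinuousLinearMap.fst ℝ ℝ V3))) z := by
  have hUc : DifferentiableAt ℝ (fun w => U (ssMap T r x₀ w) j) z :=
    (hasFDerivAt_comp_ssMap (differentiableAt_euclidean.mp hU j)).differentiableAt
  exact (((ssCov_hasFDerivAt_const_mul_exp (T ^ (1 - 1 / r)) (r - 1) z).const_mul r).fun_mul
    hUc.hasFDerivAt).congr_of_eventuallyEq (Filter.Eventually.of_forall fun w => ssVelocity_apply T r x₀ U w j)

end SsCalculus

variable {T r : ℝ} {x₀ : V3} {z : ℝ × V3}

/-- Invariance of the packing: `𝒫 D(τ)³ = ρ σ³` with `D(τ) = σ T^{1/r-1} e^{(r-1)τ}`, `T > 0`. [folklore] -/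
theorem ssDensity_mul_diameter_pow (hT : 0 < T) (r σ : ℝ) (x₀ : V3) (P : ℝ × V3 → ℝ) (w : ℝ × V3) :
    ssDensity T r x₀ P w * (σ * (T ^ (1 / r - 1) * Real.exp ((r - 1) * w.1))) ^ 3 =
      P (ssMap T r x₀ w) * σ ^ 3 := by
  have h1 : T ^ (3 - 3 / r) * (T ^ (1 / r - 1)) ^ 3 = 1 := by
    rw [← Real.rpow_natCast, ← Real.rpow_mul hT.le, ← Real.rpow_add hT]
    convert Real.rpow_zero T using 2
    push_cast
    ring
  have h2 : Real.exp (-((3 * r - 3) * w.1)) * Real.exp ((r - 1) * w.1) ^ 3 = 1 := by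
    rw [← Real.exp_nat_mul, ← Real.exp_add]
    convert Real.exp_zero using 2
    push_cast
    ring
  calc ssDensity T r x₀ P w * (σ * (T ^ (1 / r - 1) * Real.exp ((r - 1) * w.1))) ^ 3
      = (T ^ (3 - 3 / r) * (T ^ (1 / r - 1)) ^ 3) *
          (Real.exp (-((3 * r - 3) * w.1)) * Real.exp ((r - 1) * w.1) ^ 3) *
          (P (ssMap T r x₀ w) * σ ^ 3) := by
        simp only [ssDensity]; ring
    _ = P (ssMap T r x₀ w) * σ ^ 3 := by rw [h1, h2, one_mul, one_mul]

/-- The self-similar pressure `𝒫 Θ̂ Z(𝒫 D³)` is `r² s^{5-5/r} · (ρ θ Z(ρ σ³)) ∘ ssMap`. [folklore] -/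
theorem ssPressure_eq (hT : 0 < T) (r σ : ℝ) (x₀ : V3) (Z : ℝ → ℝ) (P Θ : ℝ × V3 → ℝ) :
    (fun w => ssDensity T r x₀ P w * ssTemperature T r x₀ Θ w *
        Z (ssDensity T r x₀ P w * (σ * (T ^ (1 / r - 1) * Real.exp ((r - 1) * w.1))) ^ 3)) =
      fun w => (T ^ (3 - 3 / r) * Real.exp (-((3 * r - 3) * w.1))) *
        (r ^ 2 * (T ^ (2 - 2 / r) * Real.exp (-((2 * r - 2) * w.1)))) *
        (P (ssMap T r x₀ w) * Θ (ssMap T r x₀ w) * Z (P (ssMap T r x₀ w) * σ ^ 3)) := by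
  funext w
  rw [ssDensity_mul_diameter_pow hT]
  simp only [ssDensity, ssTemperature]
  ring

/-! ## Atoms: the composite powers through `T`, `T^{1/r}`, `e^{-τ}`, `e^{-rτ}` -/

section Atoms

/-- `T^{1-1/r} = T / T^{1/r}`. [folklore] -/
theorem ssCov_rpow_one_sub (hT : 0 < T) (r : ℝ) : T ^ (1 - 1 / r) = T / T ^ (1 / r) := by
  rw [Real.rpow_sub hT, Real.rpow_one]

/-- `T^{2-2/r} = T² / (T^{1/r})²`. [folklore] -/
theorem ssCov_rpow_two_sub (hT : 0 < T) (r : ℝ) : T ^ (2 - 2 / r) = T ^ 2 / (T ^ (1 / r)) ^ 2 := by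
  rw [Real.rpow_sub hT, Real.rpow_two, ← Real.rpow_natCast (T ^ (1 / r)), ← Real.rpow_mul hT.le]
  congr 2
  push_cast
  ring

/-- `T^{3-3/r} = T³ / (T^{1/r})³`. [folklore] -/
theorem ssCov_rpow_three_sub (hT : 0 < T) (r : ℝ) : T ^ (3 - 3 / r) = T ^ 3 / (T ^ (1 / r)) ^ 3 := by
  rw [Real.rpow_sub hT, Real.rpow_ofNat, ← Real.rpow_natCast (T ^ (1 / r)), ← Real.rpow_mul hT.le]
  congr 2
  push_cast
  ring

/-- `e^{-(r-1)τ} = e^{-rτ} / e^{-τ}`. [folklore] -/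
theorem ssCov_exp_neg_sub_one_mul (r τ : ℝ) :
    Real.exp (-((r - 1) * τ)) = Real.exp (-(r * τ)) / Real.exp (-τ) := by
  rw [eq_div_iff (Real.exp_pos _).ne', ← Real.exp_add]
  congr 1
  ring

/-- `e^{-(2r-2)τ} = (e^{-rτ})² / (e^{-τ})²`. [folklore] -/
theorem ssCov_exp_neg_two_mul (r τ : ℝ) :
    Real.exp (-((2 * r - 2) * τ)) = Real.exp (-(r * τ)) ^ 2 / Real.exp (-τ) ^ 2 := by
  rw [eq_div_iff (pow_ne_zero _ (Real.exp_pos _).ne'), ← Real.exp_nat_mul, ← Real.exp_nat_mul,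
    ← Real.exp_add]
  congr 1
  push_cast
  ring

/-- `e^{-(3r-3)τ} = (e^{-rτ})³ / (e^{-τ})³`. [folklore] -/
theorem ssCov_exp_neg_three_mul (r τ : ℝ) :
    Real.exp (-((3 * r - 3) * τ)) = Real.exp (-(r * τ)) ^ 3 / Real.exp (-τ) ^ 3 := by
  rw [eq_div_iff (pow_ne_zero _ (Real.exp_pos _).ne'), ← Real.exp_nat_mul, ← Real.exp_nat_mul,
    ← Real.exp_add]
  congr 1
  push_cast
  ring

end Atoms

/-! ## The three residual identities -/

section Identities

variable {P Θ : ℝ × V3 → ℝ} {U : ℝ × V3 → V3}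

/-- **Mass.** The self-similar mass residual is `r s^{4-3/r}` times the physical one at `ssMap z`. [folklore] -/
theorem ss_mass (hT : 0 < T) (hP : DifferentiableAt ℝ P (ssMap T r x₀ z))
    (hU : DifferentiableAt ℝ U (ssMap T r x₀ z)) :
    dT (ssDensity T r x₀ P) z +
          ∑ i, dX i (fun w => ssDensity T r x₀ P w * (ssVelocity T r x₀ U w i + w.2 i)) z +
        (3 * r - 6) * ssDensity T r x₀ P z =
      (r * (T * Real.exp (-(r * z.1))) * (T ^ (3 - 3 / r) * Real.exp (-((3 * r - 3) * z.1)))) *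
        (dT P (ssMap T r x₀ z) + ∑ i, dX i (fun w => P w * U w i) (ssMap T r x₀ z)) := by
  have hUj : ∀ j, DifferentiableAt ℝ (fun w => U w j) (ssMap T r x₀ z) :=
    fun j => differentiableAt_euclidean.mp hU j
  have hD : HasFDerivAt (ssDensity T r x₀ P) _ z :=
    (ssCov_hasFDerivAt_const_mul_exp (T ^ (3 - 3 / r)) (3 * r - 3) z).fun_mul
      (hasFDerivAt_comp_ssMap hP).differentiableAt.hasFDerivAt
  have hDV := fun i =>
    (hD.fun_mul ((hasFDerivAt_ssVelocity_apply hU i).fun_add (hasFDerivAt_coord z i))).fderiv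
  have hPU := fun i => (hP.hasFDerivAt.fun_mul (hUj i).hasFDerivAt).fderiv
  unfold dT dX
  rw [hD.fderiv]
  simp only [hDV, hPU]
  simp only [add_apply, smul_apply, ContinuousLinearMap.coe_comp, Function.comp_apply,
    ContinuousLinearMap.coe_fst', ContinuousLinearMap.coe_snd', PiLp.proj_apply,
    fderiv_comp_ssMap_time hP, fderiv_comp_ssMap_space hP,
    fderiv_comp_ssMap_space (hUj _), smul_eq_mul, mul_one, mul_zero, add_zero]
  simp only [ssDensity, ssVelocity_apply, Fin.sum_univ_three, PiLp.single_apply]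
  generalize fderiv ℝ P (ssMap T r x₀ z) = DP
  generalize fderiv ℝ (fun w => U w 0) (ssMap T r x₀ z) = DU₀
  generalize fderiv ℝ (fun w => U w 1) (ssMap T r x₀ z) = DU₁
  generalize fderiv ℝ (fun w => U w 2) (ssMap T r x₀ z) = DU₂
  have hα : T ^ (1 / r) ≠ 0 := (Real.rpow_pos_of_pos hT _).ne'
  have hE : Real.exp (-z.1) ≠ 0 := (Real.exp_pos _).ne'
  have hW : Real.exp (-(r * z.1)) ≠ 0 := (Real.exp_pos _).ne'
  rw [ssCov_rpow_one_sub hT, ssCov_rpow_three_sub hT, ssCov_exp_neg_sub_one_mul,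
    ssCov_exp_neg_three_mul]
  norm_num
  field_simp
  ring


/-- **Momentum** (`j`-th component). The self-similar momentum residual is `r² s^{5-4/r}` times the physical one
at `ssMap z`: the pressure term is covariant because the packing `𝒫 D³ = ρ σ³` is, and the anomalies `-(r-1)𝒱ⱼ`
(from `∂_τ` of the prefactor `r s^{1-1/r}`) and `-s^{1/r} ζ·∇uⱼ` (from `∂_τ` of the map) are cancelled by the
typed `(r-1)𝒱ⱼ` and `(ζ·∇)𝒱ⱼ`. [folklore] -/
theorem ss_momentum (hT : 0 < T) (σ : ℝ) (Z : ℝ → ℝ) (hP : DifferentiableAt ℝ P (ssMap T r x₀ z))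
    (hΘ : DifferentiableAt ℝ Θ (ssMap T r x₀ z)) (hU : DifferentiableAt ℝ U (ssMap T r x₀ z))
    (hZ : DifferentiableAt ℝ Z (P (ssMap T r x₀ z) * σ ^ 3)) (j : Fin 3) :
    ssDensity T r x₀ P z * (dT (fun w => ssVelocity T r x₀ U w j) z + (r - 1) * ssVelocity T r x₀ U z j +
          ∑ i, (z.2 i + ssVelocity T r x₀ U z i) * dX i (fun w => ssVelocity T r x₀ U w j) z) +
        dX j (fun w => ssDensity T r x₀ P w * ssTemperature T r x₀ Θ w *
          Z (ssDensity T r x₀ P w * (σ * (T ^ (1 / r - 1) * Real.exp ((r - 1) * w.1))) ^ 3)) z =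
      ((T ^ (3 - 3 / r) * Real.exp (-((3 * r - 3) * z.1))) *
          (r * (T ^ (1 - 1 / r) * Real.exp (-((r - 1) * z.1)))) * (r * (T * Real.exp (-(r * z.1))))) *
        (P (ssMap T r x₀ z) * (dT (fun w => U w j) (ssMap T r x₀ z) +
            ∑ i, U (ssMap T r x₀ z) i * dX i (fun w => U w j) (ssMap T r x₀ z)) +
          dX j (fun w => P w * Θ w * Z (P w * σ ^ 3)) (ssMap T r x₀ z)) := by
  have hUj : ∀ j, DifferentiableAt ℝ (fun w => U w j) (ssMap T r x₀ z) :=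
    fun j => differentiableAt_euclidean.mp hU j
  have hPres : DifferentiableAt ℝ (fun w => P w * Θ w * Z (P w * σ ^ 3)) (ssMap T r x₀ z) :=
    (hP.fun_mul hΘ).fun_mul (hZ.fun_comp' (ssMap T r x₀ z) (hP.mul_const (σ ^ 3)))
  have hPr : HasFDerivAt (fun w => (T ^ (3 - 3 / r) * Real.exp (-((3 * r - 3) * w.1))) *
        (r ^ 2 * (T ^ (2 - 2 / r) * Real.exp (-((2 * r - 2) * w.1)))) *
        (P (ssMap T r x₀ w) * Θ (ssMap T r x₀ w) * Z (P (ssMap T r x₀ w) * σ ^ 3))) _ z :=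
    ((ssCov_hasFDerivAt_const_mul_exp (T ^ (3 - 3 / r)) (3 * r - 3) z).fun_mul
      ((ssCov_hasFDerivAt_const_mul_exp (T ^ (2 - 2 / r)) (2 * r - 2) z).const_mul (r ^ 2))).fun_mul
      (hasFDerivAt_comp_ssMap hPres).differentiableAt.hasFDerivAt
  have hVd := fun j => (hasFDerivAt_ssVelocity_apply hU j).fderiv
  unfold dT dX
  rw [ssPressure_eq hT, hPr.fderiv]
  simp only [hVd]
  simp only [add_apply, smul_apply, ContinuousLinearMap.coe_fst', fderiv_comp_ssMap_time (hUj _),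
    fderiv_comp_ssMap_space (hUj _), fderiv_comp_ssMap_space hPres, smul_eq_mul, mul_one, mul_zero, add_zero]
  simp only [ssDensity, ssVelocity_apply, Fin.sum_univ_three]
  generalize fderiv ℝ (fun w => U w j) (ssMap T r x₀ z) = DU
  generalize fderiv ℝ (fun w => P w * Θ w * Z (P w * σ ^ 3)) (ssMap T r x₀ z) = DPr
  have hα : T ^ (1 / r) ≠ 0 := (Real.rpow_pos_of_pos hT _).ne'
  have hE : Real.exp (-z.1) ≠ 0 := (Real.exp_pos _).ne'
  have hW : Real.exp (-(r * z.1)) ≠ 0 := (Real.exp_pos _).ne'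
  rw [ssCov_rpow_one_sub hT, ssCov_rpow_two_sub hT, ssCov_rpow_three_sub hT, ssCov_exp_neg_sub_one_mul,
    ssCov_exp_neg_two_mul, ssCov_exp_neg_three_mul]
  norm_num
  field_simp
  ring

/-- **Temperature.** The self-similar temperature residual is `r³ s^{3-2/r}` times the physical one at `ssMap z`
once the typed heating `H Θ̂ (Z − 1)`, `H(τ) = r s h(t)`, is subtracted; the anomalies `-2(r-1)Θ̂` and
`-s^{1/r} ζ·∇θ` are cancelled by the typed `2(r-1)Θ̂` and `ζ·∇Θ̂`. [folklore] -/
theorem ss_temperature (hT : 0 < T) (σ : ℝ) (h Z : ℝ → ℝ) (P : ℝ × V3 → ℝ)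
    (hΘ : DifferentiableAt ℝ Θ (ssMap T r x₀ z)) (hU : DifferentiableAt ℝ U (ssMap T r x₀ z)) :
    dT (ssTemperature T r x₀ Θ) z + 2 * (r - 1) * ssTemperature T r x₀ Θ z +
            ∑ i, (z.2 i + ssVelocity T r x₀ U z i) * dX i (ssTemperature T r x₀ Θ) z +
          2 / 3 * ssTemperature T r x₀ Θ z *
              Z (ssDensity T r x₀ P z * (σ * (T ^ (1 / r - 1) * Real.exp ((r - 1) * z.1))) ^ 3) *
            ∑ i, dX i (fun w => ssVelocity T r x₀ U w i) z -
        r * (T * Real.exp (-(r * z.1))) * h (T - T * Real.exp (-(r * z.1))) * ssTemperature T r x₀ Θ z *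
          (Z (ssDensity T r x₀ P z * (σ * (T ^ (1 / r - 1) * Real.exp ((r - 1) * z.1))) ^ 3) - 1) =
      ((r ^ 2 * (T ^ (2 - 2 / r) * Real.exp (-((2 * r - 2) * z.1)))) * (r * (T * Real.exp (-(r * z.1))))) *
        (dT Θ (ssMap T r x₀ z) + ∑ i, U (ssMap T r x₀ z) i * dX i Θ (ssMap T r x₀ z) +
            2 / 3 * Θ (ssMap T r x₀ z) * Z (P (ssMap T r x₀ z) * σ ^ 3) *
              ∑ i, dX i (fun w => U w i) (ssMap T r x₀ z) -
          h (ssMap T r x₀ z).1 * Θ (ssMap T r x₀ z) * (Z (P (ssMap T r x₀ z) * σ ^ 3) - 1)) := by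
  have hUj : ∀ j, DifferentiableAt ℝ (fun w => U w j) (ssMap T r x₀ z) :=
    fun j => differentiableAt_euclidean.mp hU j
  have hTh : HasFDerivAt (ssTemperature T r x₀ Θ) _ z :=
    ((ssCov_hasFDerivAt_const_mul_exp (T ^ (2 - 2 / r)) (2 * r - 2) z).const_mul (r ^ 2)).fun_mul
      (hasFDerivAt_comp_ssMap hΘ).differentiableAt.hasFDerivAt
  have hVd := fun j => (hasFDerivAt_ssVelocity_apply hU j).fderiv
  have hp1 : (ssMap T r x₀ z).1 = T - T * Real.exp (-(r * z.1)) := rfl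
  rw [ssDensity_mul_diameter_pow hT, hp1]
  unfold dT dX
  rw [hTh.fderiv]
  simp only [hVd]
  simp only [add_apply, smul_apply, ContinuousLinearMap.coe_fst', fderiv_comp_ssMap_time hΘ,
    fderiv_comp_ssMap_space hΘ, fderiv_comp_ssMap_space (hUj _), smul_eq_mul, mul_one, mul_zero, add_zero]
  simp only [ssTemperature, ssVelocity_apply, Fin.sum_univ_three]
  generalize fderiv ℝ Θ (ssMap T r x₀ z) = DΘ
  generalize fderiv ℝ (fun w => U w 0) (ssMap T r x₀ z) = DU₀
  generalize fderiv ℝ (fun w => U w 1) (ssMap T r x₀ z) = DU₁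
  generalize fderiv ℝ (fun w => U w 2) (ssMap T r x₀ z) = DU₂
  generalize Z (P (ssMap T r x₀ z) * σ ^ 3) = Zc
  generalize h (T - T * Real.exp (-(r * z.1))) = hc
  have hα : T ^ (1 / r) ≠ 0 := (Real.rpow_pos_of_pos hT _).ne'
  have hE : Real.exp (-z.1) ≠ 0 := (Real.exp_pos _).ne'
  have hW : Real.exp (-(r * z.1)) ≠ 0 := (Real.exp_pos _).ne'
  rw [ssCov_rpow_one_sub hT, ssCov_rpow_two_sub hT, ssCov_exp_neg_sub_one_mul, ssCov_exp_neg_two_mul]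
  norm_num
  field_simp
  ring

end Identities

/-! ## The registered stub -/

/-- **STUB W1 of the line `r2-one-mode-two-conditions`** (crux `ImplosionDichotomy.DenseExcursion`,
stmt-AtomisticToContinuum-12586): the dynamical self-similar change of variables of the full Euler system of a
monatomic gas with a general equation of state `p = ρ θ Z(ρ d³)` — the physical system with diameter `σ` and
heating rate `h(t) θ (Z-1)` holds at `(t, x) = ssMap T r x₀ (τ, ζ)` iff the self-similar system with the growing
diameter `D(τ) = σ T^{1/r-1} e^{(r-1)τ}` and heating `H(τ) = r T e^{-rτ} h(T - T e^{-rτ})` holds at `(τ, ζ)` for the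
self-similar fields `(𝒫, Θ̂, 𝒱)`. Pure chain rule: the self-similar mass / momentum / temperature residuals are
`r s^{4-3/r}`, `r² s^{5-4/r}`, `r³ s^{3-2/r}` times the physical ones (the last after subtracting the typed
heating), and these factors are nonzero because `0 < T`, `0 < r`. [folklore] -/
theorem stub_selfSimilarCovariance : SelfSimilarCovariance := by
  intro T r σ hT hr x₀ h Z P Θ U z hP hΘ hU hZ
  have h1 : r * (T * Real.exp (-(r * z.1))) * (T ^ (3 - 3 / r) * Real.exp (-((3 * r - 3) * z.1))) ≠ 0 := by
    positivity
  have h2 : (T ^ (3 - 3 / r) * Real.exp (-((3 * r - 3) * z.1))) *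
      (r * (T ^ (1 - 1 / r) * Real.exp (-((r - 1) * z.1)))) * (r * (T * Real.exp (-(r * z.1)))) ≠ 0 := by
    positivity
  have h3 : (r ^ 2 * (T ^ (2 - 2 / r) * Real.exp (-((2 * r - 2) * z.1)))) *
      (r * (T * Real.exp (-(r * z.1)))) ≠ 0 := by
    positivity
  unfold EulerZAt SelfSimEulerZAt
  exact and_congr (eq_zero_iff_of_eq_mul (ss_mass hT hP hU) h1)
    (and_congr
      (forall_congr' fun j => eq_zero_iff_of_eq_mul (ss_momentum hT σ Z hP hΘ hU hZ j) h2)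
      (eq_iff_of_sub_eq_mul_sub (ss_temperature hT σ h Z P hΘ hU) h3))


end Summit.AtomisticToContinuum.HydrodynamicLimit.Theorems.R2OneModeTwoConditions

end
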